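import Summits.CriticalPhenomena.PercolationContinuityZ3.Theorems.SoloBlindPeriodicFin
import HarnessLib

/-!
# Fins attached along a periodic set of feet, III: the kernel estimates and the theorem

Seat `solo-CriticalPhenomena-blind`.  We bound the two kernel norms of `SoloBlindPeriodicFin`
for the period-`M` foot set `Z_M = Mℤ`:
* fin side: `kerTot(false) ≤ C(c) · r^{M-1}` with `r = e^{-c} < 1` from the planar exponential
  decay `exists_exp_decay_finFeet` (`p_c(ℤ³) < p_c(ℤ²)`), where `C(c) = Σ_{j ≠ 0} r^{|j|-1} < ∞`;
* half-space side: `kerTot(true) ≤ Σ_{w ∈ ℤ} P(0 ↔ (0,0,w) in ℍ)`, finite under `LineRate`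
  (translation invariance along the `x₂`-axis, `bondPercolation_map_shift`);
and conclude **`periodicFin_of_lineRate`**: under `LineRate` there is `M₀` with
`θ_{S_{Mℤ}}(p_c) = 0` at the origin for all `M ≥ M₀`.
-/

noncomputable section

namespace Summit.CriticalPhenomena.PercolationContinuityZ3.Theorems

open MeasureTheory Filter Topology Literature.Probability.Percolation Literature.Probability.LatticeModels
open scoped ENNReal

/-- The period-`M` foot set. -/
def ZM (M : ℕ) : Set ℤ := {z | (M : ℤ) ∣ z}

/-- The half-space two-point function along the `x₂`-axis: `τ(w) = P(0 ↔ (0,0,w) inside ℍ)`. -/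
def tauH (w : ℤ) : ℝ≥0∞ :=
  Pc (openConnVia (withinGraph (zdGraph 3) hsp) (0 : Site 3) (Function.update (0 : Site 3) 2 w))

/-! ### Relabelling and translation invariance -/

/-- Relabelling along a graph isomorphism transports restricted connection events. -/
theorem relabel_preimage_openConnVia {V V' : Type*} (e : V ≃ V') {K : SimpleGraph V}
    {K' : SimpleGraph V'} (hK : ∀ u v, K'.Adj (e u) (e v) ↔ K.Adj u v) (x y : V) :
    BondConfig.relabel (sym2Equiv e) ⁻¹' openConnVia K' (e x) (e y) = openConnVia K x y := by
  ext ω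
  show e y ∈ openClusterIn K' (BondConfig.relabel (sym2Equiv e) ω) (e x) ↔ y ∈ openClusterIn K ω x
  rw [openClusterIn_relabel e hK ω x]
  exact e.injective.mem_set_image

/-- Differences of axis points are axis points. -/
theorem update_two_sub (z z' : ℤ) :
    Function.update (0 : Site 3) 2 z' - Function.update (0 : Site 3) 2 z =
      Function.update (0 : Site 3) 2 (z' - z) := by
  ext i
  by_cases hi : i = 2
  · subst hi; simp
  · simp [hi]

/-- Sums of axis points are axis points. -/
theorem update_two_add (z w : ℤ) :
    Function.update (0 : Site 3) 2 w + Function.update (0 : Site 3) 2 z =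
      Function.update (0 : Site 3) 2 (w + z) := by
  ext i
  by_cases hi : i = 2
  · subst hi; simp
  · simp [hi]

/-- Translation invariance of the half-space two-point function along the `x₂`-axis. -/
theorem measure_openConnVia_hsp_shift (z w : ℤ) :
    Pc (openConnVia (withinGraph (zdGraph 3) hsp) (Function.update (0 : Site 3) 2 z)
      (Function.update (0 : Site 3) 2 (w + z))) = tauH w := by
  let v : Site 3 := Function.update (0 : Site 3) 2 z
  have hv0 : v 0 = 0 := by simp [v]
  have hK : ∀ u u' : Site 3, (withinGraph (zdGraph 3) hsp).Adj (Site.shift v u) (Site.shift v u') ↔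
      (withinGraph (zdGraph 3) hsp).Adj u u' := by
    intro u u'
    rw [withinGraph_adj, withinGraph_adj, zdGraph_adj_shift_iff]
    simp only [hsp, Set.mem_setOf_eq, Site.shift_apply, Pi.add_apply, hv0, add_zero]
  have hpre := relabel_preimage_openConnVia (Site.shift v) hK (0 : Site 3) (Function.update 0 2 w)
  have hreal := bondPercolation_real_preimage_shift v (criticalProbI 3)
    (openConnVia (withinGraph (zdGraph 3) hsp) (Site.shift v 0) (Site.shift v (Function.update 0 2 w)))
  rw [hpre] at hreal
  rw [measureReal_def, measureReal_def,
    ENNReal.toReal_eq_toReal_iff' (measure_ne_top _ _) (measure_ne_top _ _)] at hreal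
  have h0 : Site.shift v 0 = v := by ext i; simp [Site.shift_apply]
  have hw : Site.shift v (Function.update 0 2 w) = Function.update (0 : Site 3) 2 (w + z) := by
    rw [Site.shift_apply, update_two_add]
  rw [h0, hw] at hreal
  exact hreal.symm

/-- `LineRate` makes `Σ_w τ_ℍ(w)` finite. -/
theorem tsum_tauH_ne_top (hL : SoloBlindOpenRungs.LineRate) : ∑' w, tauH w ≠ ⊤ := by
  have h : ∀ w, tauH w = ((tauH w).toNNReal : ℝ≥0∞) := fun w => (ENNReal.coe_toNNReal (measure_ne_top _ _)).symm
  rw [tsum_congr h]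
  exact ENNReal.tsum_coe_ne_top_iff_summable_coe.2 hL

/-! ### The half-space kernel -/

/-- A half-space piece connection between connector endpoints costs at most `τ_ℍ`. -/
theorem measure_openConnVia_K0_hsp_le (Z : Set ℤ) (z z' : ℤ) :
    Pc (openConnVia (K0 Z) (cpt true z) (cpt true z')) ≤ tauH (z' - z) := by
  have hsub : openConnVia (K0 Z) (cpt true z) (cpt true z') ⊆
      openConnVia (withinGraph (zdGraph 3) hsp) (cpt true z) (cpt true z') :=
    fun ω hω => piece_subset_of_mem_hsp (cpt_true_mem_hsp z) hω
  refine (measure_mono hsub).trans_eq ?_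
  have := measure_openConnVia_hsp_shift z (z' - z)
  rwa [sub_add_cancel] at this

/-- The half-space kernel is dominated by the half-space two-point function. -/
theorem kerZ_true_le (Z : Set ℤ) (z z' : ℤ) : kerZ Z true z z' ≤ tauH (z' - z) := by
  unfold kerZ
  calc admInd Z z z' * (Pc (openConnVia (K0 Z) (cpt true z) (cpt true z')) *
        Pc {ω | s(cpt true z', cpt (!true) z') ∈ ω})
      ≤ 1 * (tauH (z' - z) * 1) :=
        mul_le_mul' (admInd_le_one z z') (mul_le_mul' (measure_openConnVia_K0_hsp_le Z z z') prob_le_one)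
    _ = tauH (z' - z) := by rw [one_mul, mul_one]

/-- The half-space kernel norm is at most `Σ_w τ_ℍ(w)`. -/
theorem kerTot_true_le (Z : Set ℤ) : kerTot (kerZ Z) true ≤ ∑' w, tauH w := by
  refine iSup_le fun z => ?_
  calc ∑' z', kerZ Z true z z' ≤ ∑' z', tauH (z' - z) := ENNReal.tsum_le_tsum (kerZ_true_le Z z)
    _ = ∑' w, tauH w := (Equiv.subRight z).tsum_eq tauH

/-- The start weights from the origin sum to at most `Σ_w τ_ℍ(w)`. -/
theorem tsum_startZ_le (Z : Set ℤ) : ∑' z, startZ Z (0 : Site 3) true z ≤ ∑' w, tauH w := by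
  refine ENNReal.tsum_le_tsum fun z => ?_
  unfold startZ
  have hsub : openConnVia (K0 Z) (0 : Site 3) (cpt true z) ⊆
      openConnVia (withinGraph (zdGraph 3) hsp) 0 (cpt true z) :=
    fun ω hω => piece_subset_of_mem_hsp zero_mem_hsp hω
  calc Set.indicator Z (fun _ => (1 : ℝ≥0∞)) z * (Pc (openConnVia (K0 Z) 0 (cpt true z)) *
        Pc {ω | s(cpt true z, cpt (!true) z) ∈ ω})
      ≤ 1 * (tauH z * 1) := by
        refine mul_le_mul' (Set.indicator_le (fun _ _ => le_rfl) z) (mul_le_mul' ?_ prob_le_one)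
        exact measure_mono hsub
    _ = tauH z := by rw [one_mul, mul_one]

/-! ### The fin kernel -/

/-- The fin lies in the planar region `{x₁ = 0, x₀ ≤ -1}`. -/
theorem finZ_subset_plane (Z : Set ℤ) : finZ Z ⊆ {x : Site 3 | x 1 = 0 ∧ x 0 ≤ -1} := by
  rintro x (⟨h1, h0⟩ | ⟨h1, h0, -⟩)
  · exact ⟨h1, by omega⟩
  · exact ⟨h1, by omega⟩

/-- The fin kernel is dominated by the planar exponential decay between feet. -/
theorem kerZ_false_le {c : ℝ}
    (hc : ∀ z z' : ℤ, z ≠ z' → Pc (openConnVia (withinGraph (zdGraph 3) {x : Site 3 | x 1 = 0 ∧ x 0 ≤ -1})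
      (Function.update (0 : Site 3) 2 z - Pi.single 0 1) (Function.update (0 : Site 3) 2 z' - Pi.single 0 1)) ≤
      ENNReal.ofReal (Real.exp (-c * ((z - z').natAbs - 1 : ℕ))))
    (Z : Set ℤ) (z z' : ℤ) :
    kerZ Z false z z' ≤ admInd Z z z' * ENNReal.ofReal (Real.exp (-c * ((z - z').natAbs - 1 : ℕ))) := by
  unfold kerZ
  by_cases h : z ∈ Z ∧ z' ∈ Z ∧ z' ≠ z
  · obtain ⟨hz, hz', hne⟩ := h
    refine mul_le_mul' le_rfl ((mul_le_mul' (le_refl _) prob_le_one).trans ?_)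
    rw [mul_one]
    have hsub : openConnVia (K0 Z) (cpt false z) (cpt false z') ⊆
        openConnVia (withinGraph (zdGraph 3) {x : Site 3 | x 1 = 0 ∧ x 0 ≤ -1}) (cpt false z) (cpt false z') :=
      fun ω hω => openClusterIn_mono_graph (withinGraph_mono _ (finZ_subset_plane Z)) ω _
        (piece_subset_of_mem_finZ (cpt_mem_sideSet (Z := Z) false hz) hω)
    exact (measure_mono hsub).trans (hc z z' (Ne.symm hne))
  · rw [admInd_eq_zero h, zero_mul, zero_mul]

/-- The constant `C(r) = Σ_{j ≠ 0} r^{|j| - 1} = 2 (1 - r)⁻¹`. -/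
theorem tsum_int_ne_zero_pow (r : ℝ≥0∞) :
    ∑' j : ℤ, Set.indicator {j : ℤ | j ≠ 0} (fun j => r ^ (j.natAbs - 1)) j = 2 * (1 - r)⁻¹ := by
  rw [← Equiv.intEquivNatSumNat.symm.tsum_eq]
  rw [Summable.tsum_sum ENNReal.summable ENNReal.summable]
  have h1 : ∑' n : ℕ, Set.indicator {j : ℤ | j ≠ 0} (fun j => r ^ (j.natAbs - 1))
      (Equiv.intEquivNatSumNat.symm (Sum.inl n)) = ∑' n : ℕ, r ^ n := by
    rw [tsum_eq_zero_add' ENNReal.summable]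
    have h0 : Set.indicator {j : ℤ | j ≠ 0} (fun j => r ^ (j.natAbs - 1))
        (Equiv.intEquivNatSumNat.symm (Sum.inl 0)) = 0 := Set.indicator_of_notMem (by simp [Equiv.intEquivNatSumNat]) _
    rw [h0, zero_add]
    refine tsum_congr fun n => ?_
    rw [Set.indicator_of_mem]
    · show r ^ ((Equiv.intEquivNatSumNat.symm (Sum.inl (n + 1))).natAbs - 1) = r ^ n
      have h' : (Equiv.intEquivNatSumNat.symm (Sum.inl (n + 1))).natAbs = n + 1 := rfl
      rw [h', Nat.add_sub_cancel]
    · show ((n + 1 : ℕ) : ℤ) ≠ 0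
      omega
  have h2 : ∑' n : ℕ, Set.indicator {j : ℤ | j ≠ 0} (fun j => r ^ (j.natAbs - 1))
      (Equiv.intEquivNatSumNat.symm (Sum.inr n)) = ∑' n : ℕ, r ^ n := by
    refine tsum_congr fun n => ?_
    rw [Set.indicator_of_mem]
    · show r ^ ((Equiv.intEquivNatSumNat.symm (Sum.inr n)).natAbs - 1) = r ^ n
      have h' : (Equiv.intEquivNatSumNat.symm (Sum.inr n)).natAbs = n + 1 := rfl
      rw [h', Nat.add_sub_cancel]
    · show Int.negSucc n ≠ 0
      exact Int.negSucc_ne_zero n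
  rw [h1, h2, ENNReal.tsum_geometric, two_mul]

/-- The fin kernel norm for `Z_M`: `kerTot(false) ≤ r^{M-1} · 2 (1-r)⁻¹` with `r = e^{-c}`. -/
theorem kerTot_false_le {c : ℝ} (hc0 : 0 < c)
    (hc : ∀ z z' : ℤ, z ≠ z' → Pc (openConnVia (withinGraph (zdGraph 3) {x : Site 3 | x 1 = 0 ∧ x 0 ≤ -1})
      (Function.update (0 : Site 3) 2 z - Pi.single 0 1) (Function.update (0 : Site 3) 2 z' - Pi.single 0 1)) ≤
      ENNReal.ofReal (Real.exp (-c * ((z - z').natAbs - 1 : ℕ))))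
    (M : ℕ) (hM : 1 ≤ M) :
    kerTot (kerZ (ZM M)) false ≤
      ENNReal.ofReal (Real.exp (-c)) ^ (M - 1) * (2 * (1 - ENNReal.ofReal (Real.exp (-c)))⁻¹) := by
  set r : ℝ≥0∞ := ENNReal.ofReal (Real.exp (-c)) with hr
  have hr1 : r ≤ 1 := ENNReal.ofReal_le_one.2 (by rw [Real.exp_le_one_iff]; linarith)
  have hexp : ∀ k : ℕ, ENNReal.ofReal (Real.exp (-c * k)) = r ^ k := fun k => by
    rw [hr, ← ENNReal.ofReal_pow (Real.exp_pos _).le, ← Real.exp_nat_mul, mul_comm]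
  have hMne : M ≠ 0 := by omega
  have hM0 : (M : ℤ) ≠ 0 := by exact_mod_cast hMne
  refine iSup_le fun z => ?_
  by_cases hz : z ∈ ZM M
  swap
  · have : ∀ z', kerZ (ZM M) false z z' = 0 := fun z' => by
      rw [kerZ, admInd_eq_zero (fun h => hz h.1), zero_mul]
    simp [tsum_congr this]
  obtain ⟨a, rfl⟩ := hz
  -- reindex the admissible heights `z' = M (a + j)`, `j ≠ 0`
  let g : ℤ → ℤ := fun j => (M : ℤ) * a + (M : ℤ) * j
  have hg : Function.Injective g := fun j j' h => by
    simpa [g, hMne] using h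
  let F : ℤ → ℝ≥0∞ := fun z' => admInd (ZM M) ((M : ℤ) * a) z' *
    ENNReal.ofReal (Real.exp (-c * (((M : ℤ) * a - z').natAbs - 1 : ℕ)))
  have hsupp : Function.support F ⊆ Set.range g := by
    intro z' hz'
    by_contra hno
    apply hz'
    have : ¬((M : ℤ) * a ∈ ZM M ∧ z' ∈ ZM M ∧ z' ≠ (M : ℤ) * a) := by
      rintro ⟨-, ⟨b, rfl⟩, -⟩
      exact hno ⟨b - a, by simp [g]; ring⟩
    simp [F, admInd_eq_zero this]
  calc ∑' z', kerZ (ZM M) false ((M : ℤ) * a) z' ≤ ∑' z', F z' :=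
        ENNReal.tsum_le_tsum fun z' => kerZ_false_le hc (ZM M) _ z'
    _ = ∑' j, F (g j) := (hg.tsum_eq hsupp).symm
    _ ≤ ∑' j : ℤ, r ^ (M - 1) * Set.indicator {j : ℤ | j ≠ 0} (fun j => r ^ (j.natAbs - 1)) j := by
        refine ENNReal.tsum_le_tsum fun j => ?_
        by_cases hj : j = 0
        · subst hj
          have : ¬((M : ℤ) * a ∈ ZM M ∧ g 0 ∈ ZM M ∧ g 0 ≠ (M : ℤ) * a) := fun h => h.2.2 (by simp [g])
          simp [F, admInd_eq_zero this]
        · rw [Set.indicator_of_mem (by exact hj)]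
          calc F (g j) ≤ 1 * ENNReal.ofReal (Real.exp (-c * ((((M : ℤ) * a - g j).natAbs - 1 : ℕ)))) :=
                mul_le_mul' (admInd_le_one _ _) le_rfl
            _ = r ^ (M * j.natAbs - 1) := by
                rw [one_mul, hexp]
                congr 2
                simp only [g, sub_add_cancel_left, Int.natAbs_neg, Int.natAbs_mul, Int.natAbs_natCast]
            _ ≤ r ^ ((M - 1) + (j.natAbs - 1)) := by
                refine pow_le_pow_right_of_le_one' hr1 ?_
                have hj1 : 1 ≤ j.natAbs := Int.natAbs_pos.2 hj
                obtain ⟨M₁, hM₁⟩ : ∃ M₁, M = M₁ + 1 := ⟨M - 1, by omega⟩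
                obtain ⟨B₁, hB₁⟩ : ∃ B₁, j.natAbs = B₁ + 1 := ⟨j.natAbs - 1, by omega⟩
                rw [hM₁, hB₁]
                have : (M₁ + 1) * (B₁ + 1) = M₁ * B₁ + M₁ + B₁ + 1 := by ring
                rw [this]
                omega
            _ = r ^ (M - 1) * r ^ (j.natAbs - 1) := pow_add _ _ _
    _ = r ^ (M - 1) * (2 * (1 - r)⁻¹) := by rw [ENNReal.tsum_mul_left, tsum_int_ne_zero_pow]

/-! ### The theorem -/

/-- **Periodic fins under `LineRate`.** If `Σ_z P_{p_c}(0 ↔ (0,0,z) in ℍ) < ∞` then for all large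
periods `M` the half-space with a half-plane glued on along the feet `(-1,0,Mj)`, `j ∈ ℤ`,
`S = {0 ≤ x₀} ∪ {x₁ = 0, x₀ ≤ -2} ∪ {x₁ = 0, x₀ = -1, M ∣ x₂}`, has `θ_{G[S]}(p_c(ℤ³)) = 0` at the
origin.  (The case `M = 1`, the full fin, is `SoloBlindOpenRungs.FinRung`.) -/
theorem periodicFin_of_lineRate (hL : SoloBlindOpenRungs.LineRate) :
    ∃ M₀ : ℕ, ∀ M : ℕ, M₀ ≤ M → ∀ h0 : (0 : Site 3) ∈ ({x : Site 3 | 0 ≤ x 0} ∪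
        {x : Site 3 | (x 1 = 0 ∧ x 0 ≤ -2) ∨ (x 1 = 0 ∧ x 0 = -1 ∧ (M : ℤ) ∣ x 2)}),
      theta ((zdGraph 3).induce ({x : Site 3 | 0 ≤ x 0} ∪
        {x : Site 3 | (x 1 = 0 ∧ x 0 ≤ -2) ∨ (x 1 = 0 ∧ x 0 = -1 ∧ (M : ℤ) ∣ x 2)})) ⟨0, h0⟩
        (criticalProbI 3) = 0 := by
  obtain ⟨c, hc0, hc⟩ := RegionGluing.exists_exp_decay_finFeet
  set r : ℝ≥0∞ := ENNReal.ofReal (Real.exp (-c)) with hr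
  have hr1 : r < 1 := ENNReal.ofReal_lt_one.2 (Real.exp_lt_one_iff.2 (by linarith))
  set T : ℝ≥0∞ := ∑' w, tauH w with hT
  have hTtop : T ≠ ⊤ := tsum_tauH_ne_top hL
  have hCtop : (2 * (1 - r)⁻¹) ≠ ⊤ :=
    ENNReal.mul_ne_top (by simp) (ENNReal.inv_ne_top.2 (tsub_pos_of_lt hr1).ne')
  -- `ρ(M) ≤ T · (2 (1-r)⁻¹) · r^{M-1} → 0`
  have hlim : Tendsto (fun M : ℕ => T * (2 * (1 - r)⁻¹) * r ^ M) atTop (𝓝 0) := by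
    have := ENNReal.Tendsto.const_mul (ENNReal.tendsto_pow_atTop_nhds_zero_of_lt_one hr1)
      (Or.inr (ENNReal.mul_ne_top hTtop hCtop)) (a := T * (2 * (1 - r)⁻¹))
    rwa [mul_zero] at this
  obtain ⟨M₁, hM₁⟩ := eventually_atTop.1 (hlim.eventually_lt_const zero_lt_one)
  refine ⟨M₁ + 1, fun M hM h0 => ?_⟩
  have hρ : kerTot (kerZ (ZM M)) true * kerTot (kerZ (ZM M)) false < 1 := by
    calc kerTot (kerZ (ZM M)) true * kerTot (kerZ (ZM M)) false
        ≤ T * (r ^ (M - 1) * (2 * (1 - r)⁻¹)) :=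
          mul_le_mul' (kerTot_true_le _) (kerTot_false_le hc0 hc M (by omega))
      _ = T * (2 * (1 - r)⁻¹) * r ^ (M - 1) := by ring
      _ < 1 := hM₁ (M - 1) (by omega)
  have hzero := measure_percolatesVia_eq_zero (Z := ZM M) (0 : Site 3) true
    zero_mem_hsp (ne_top_of_le_ne_top hTtop (tsum_startZ_le _)) hρ
  rw [theta_induce_eq_real_percolatesVia, measureReal_def]
  change (Pc (percolatesVia (KS (ZM M)) 0)).toReal = 0
  rw [hzero, ENNReal.toReal_zero]

/-- Every periodic-fin rung lies BELOW the summit: `θ_{G[S]} ≤ θ_G` (`theta_induce_le_holds`). -/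
theorem periodicFin_of_percolationContinuityZ3
    (h : Literature.Probability.Percolation.PercolationContinuityZ3) (M : ℕ)
    (h0 : (0 : Site 3) ∈ ({x : Site 3 | 0 ≤ x 0} ∪
        {x : Site 3 | (x 1 = 0 ∧ x 0 ≤ -2) ∨ (x 1 = 0 ∧ x 0 = -1 ∧ (M : ℤ) ∣ x 2)})) :
    theta ((zdGraph 3).induce ({x : Site 3 | 0 ≤ x 0} ∪
        {x : Site 3 | (x 1 = 0 ∧ x 0 ≤ -2) ∨ (x 1 = 0 ∧ x 0 = -1 ∧ (M : ℤ) ∣ x 2)})) ⟨0, h0⟩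
        (criticalProbI 3) = 0 := by
  refine le_antisymm ?_ ?_
  · calc theta ((zdGraph 3).induce ({x : Site 3 | 0 ≤ x 0} ∪
            {x : Site 3 | (x 1 = 0 ∧ x 0 ≤ -2) ∨ (x 1 = 0 ∧ x 0 = -1 ∧ (M : ℤ) ∣ x 2)})) ⟨0, h0⟩
            (criticalProbI 3)
          ≤ theta (zdGraph 3) 0 (criticalProbI 3) := theta_induce_le_holds (zdGraph 3) _ 0 h0 _
      _ = 0 := h
  · unfold theta; exact measureReal_nonneg

end Summit.CriticalPhenomena.PercolationContinuityZ3.Theorems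

end
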